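import Literature.NumberTheory.EllipticCurves.PAdicOneVariableNormCoherentUnitInduceMomentsTwo
import HarnessLib

/-!
# `p = 2`: the SOCKET hypothesis `hsock` of the series-family files for the absolute norm-coherent units —
# `∫_{ℤ₂ˣ} x^{k+1} d(x⁻¹ D_{H_b}) = [S^0] D^k H_b` in the `Θ = θ ∘ (𝒪_{ℂ_F} ⊆ ℂ_F) ∘ (𝐃 → 𝒪_{ℂ_F})` currency

Topic `NumberTheory/EllipticCurves`; namespace `Literature.NumberTheory.EllipticCurves`.

De Shalit, *Iwasawa theory of elliptic curves with complex multiplication* (1987), I.3.5 (11) (p. 18).  The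
β-agnostic files `PAdicOneVariableSeriesFamily{MomentsOfCharacter, GlueOfCharacter}` take the socket (11) as the
hypothesis `hsock` in the `Θ`-currency of the family `φ : B → 𝐃⟦X⟧`; `PAdicOneVariableSeriesFamilyOfNormCoherentUnits`
discharged `hadd`/`hgal` for the absolute units `φ b := ((δ(η b))~).map ι`.  THIS file discharges `hsock` for them
when `𝕜 = ℂ_[2]` and `Θ = θ ∘ (𝒪_{ℂ_F} ⊆ ℂ_F) ∘ (𝐃 → 𝒪_{ℂ_F})` (`θ : ℂ_F → ℂ_[2]` continuous of norm `≤ 1` on `𝒪_{ℂ_F}`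
reaching the `2`-power roots of unity): `seriesFamily_hsock_of_normCoherentUnits`, from the trace-zero socket
`integral_restrictUnits_density_unitInv_pow_succ_of_colemanTrace_eq_zero` and the currency bridge
`map_subst_compSeriesC_comp_eq`.  So the absolute units instantiate ALL hypotheses of the series-family package.

Everything is proved; no named facts, no definitions, no instances (section-local instance attributes as in the
siblings), no `sorry`.

## References

* [deShalit1987] E. de Shalit, *Iwasawa theory of elliptic curves with complex multiplication* (1987),
  I.3.5 (11) (p. 18), I.3.3 (7)–(8) (p. 17).
-/

noncomputable section

open MvPowerSeries

namespace Literature.NumberTheory.EllipticCurves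

section SeriesFamilySocket

open ValuativeRel IsLocalRing Field
open Literature.NumberTheory.GaloisRepresentations Literature.NumberTheory.GaloisRepresentations.IsNonarchimedeanLocalField
  Literature.NumberTheory.GaloisRepresentations.LubinTate Literature.NumberTheory.PAdicHodge

variable {F : Type} [Field F] [ValuativeRel F] [TopologicalSpace F] [IsNonarchimedeanLocalField F]

attribute [local instance] ltNormUniformSpace ltNormIsUniformAddGroup rk1 nF nE fintypeResidueField

variable (hq : residueFieldCard F = 2) (h2 : (valuation F).IsUniformizer (((2 : ℕ) : 𝒪[F]) : F))
  {σ₀ : absoluteGaloisGroup F} (hσ₀ : IsAbsArithFrob σ₀) (u : 𝒪[F]ˣ)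
  {ε : (maxUnramifiedCompletion F)ˣ}
  (hε : maxUnramifiedCompletion.galAut F σ₀ (ε : maxUnramifiedCompletion F) =
    algebraMap 𝒪[F] (maxUnramifiedCompletion F) (u : 𝒪[F]) * (ε : maxUnramifiedCompletion F))
variable (θ : CompletedAlgClosure F →+* ℂ_[2]) (hθc : Continuous θ)
  (hθ1 : ∀ z : CBall F, ‖θ (z : CompletedAlgClosure F)‖ ≤ 1)
  (hθζ : ∀ ζ' : ℂ_[2], (∃ n : ℕ, ζ' ^ 2 ^ n = 1) →
    ∃ ζ : CompletedAlgClosure F, (∃ n : ℕ, ζ ^ 2 ^ n = 1) ∧ θ ζ = ζ')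

include hq hθc hθ1 hθζ in
/-- ★ **`hsock` for the absolute norm-coherent units** (`Θ = θ ∘ subtype ∘ algebraMap`, any bound proof in the
`Θ`-currency): `∫_{ℤ₂ˣ} x^{k+1} d((x⁻¹ D_{H_β})|_{ℤ₂ˣ}) = [S^0] D^k H_β`, `H_β = Θ((δβ)~ ∘ ϑ)`.
[cite: deShalit1987, I.3.5 (11) (p. 18)] -/
theorem seriesFamily_hsock_of_normCoherentUnits (n₀ : ℕ) (β : NormCoherentUnits (isUniformizer_unit_mul h2 u)) {C : ℝ}
    (hC : ∀ k : ℕ, ‖PowerSeries.coeff k ((PowerSeries.subst (compSeriesC h2 hσ₀ u hε)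
      ((tildeSer ((u : 𝒪[F]) * ((2 : ℕ) : 𝒪[F])) (LTCoeff.of F (u : 𝒪[F])) β.logDeriv).map
        ((intToUnrCoeff F).comp (LTCoeff.of F).symm.toRingHom))).map
      (θ.comp ((CBall F).subtype.comp (algebraMap (UnrCoeff F) (CBall F)))))‖ ≤ C) (k : ℕ) :
    (restrictUnits ((invAmice₁ 2 ((PowerSeries.subst (compSeriesC h2 hσ₀ u hε)
        ((tildeSer ((u : 𝒪[F]) * ((2 : ℕ) : 𝒪[F])) (LTCoeff.of F (u : 𝒪[F])) β.logDeriv).map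
          ((intToUnrCoeff F).comp (LTCoeff.of F).symm.toRingHom))).map
        (θ.comp ((CBall F).subtype.comp (algebraMap (UnrCoeff F) (CBall F))))) hC).density
        (ProfiniteTower.padicInt_isUniform 2) (unitInv ℂ_[2]) uniformContinuous_unitInv norm_unitInv_le)).integral
        (fun x : ℤ_[2] ↦ padicIntCast ℂ_[2] (x ^ (k + 1))) =
      PowerSeries.constantCoeff (mahlerD^[k] ((PowerSeries.subst (compSeriesC h2 hσ₀ u hε)
        ((tildeSer ((u : 𝒪[F]) * ((2 : ℕ) : 𝒪[F])) (LTCoeff.of F (u : 𝒪[F])) β.logDeriv).map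
          ((intToUnrCoeff F).comp (LTCoeff.of F).symm.toRingHom))).map
        (θ.comp ((CBall F).subtype.comp (algebraMap (UnrCoeff F) (CBall F)))))) := by
  have hbridge := map_subst_compSeriesC_comp_eq h2 hσ₀ u hε θ
    (tildeSer ((u : 𝒪[F]) * ((2 : ℕ) : 𝒪[F])) (LTCoeff.of F (u : 𝒪[F])) β.logDeriv)
  have h₁ := invAmice₁_μ_congr (p := 2) hbridge hC (norm_coeff_map_le_one θ hθ1 _)
  have h₂ := BoundedDistribution.density_μ_congr_of_μ_eq _ _ h₁ (ProfiniteTower.padicInt_isUniform 2)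
    (unitInv ℂ_[2]) uniformContinuous_unitInv norm_unitInv_le
  have h₃ := restrictUnits_μ_congr_of_μ_eq _ _ h₂
  rw [BoundedDistribution.integral_congr_of_μ_eq _ _ h₃, hbridge]
  exact integral_restrictUnits_density_unitInv_pow_succ_of_colemanTrace_eq_zero hq h2 hσ₀ u hε θ hθc hθ1 hθζ n₀ _
    (colemanTrace_tildeSer_logDeriv (isUniformizer_unit_mul h2 u) n₀ (of_unit_mul_two_eq hq u) β) k

end SeriesFamilySocket

end Literature.NumberTheory.EllipticCurves

end
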